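import Literature.AnabelianGeometry.EtaleTheta.Discharge.Sec1Rmk164HatThetaInstance
import Literature.AnabelianGeometry.EtaleTheta.Discharge.Sec2Cor219iAtModelChi
import Literature.AnabelianGeometry.EtaleTheta.ThetaSettingHatThetaModelChi
import Literature.AnabelianGeometry.EtaleTheta.Thm16SubdagStatements
import HarnessLib

/-!
# [EtTh] Rmk 1.6.4, Θ-quotient route: «(Π^tp_Ÿ)^Θ compact» ⟸ «Π^tp_Y compact», and its discharge at the
# χ-model — the RMK164 instance chain hypothesis-free at `modelχ` (proof-only)

Mochizuki, *The étale theta function and its Frobenioid-theoretic manifestations*, Publ. RIMS **45**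
(2009) [EtTh], Remark 1.6.4 p. 252 ("determines, by profinite completion, a set of classes … `∈ H¹(Π_{Ÿ^∧}, Δ_Θ)`")
[cite: MochizukiEtTh2009, Rmk 1.6.4 p.252], §1 p. 238 (`Π^tp_Y := Ker(Π^tp_X ↠ Z)`), p. 243 (`Ÿ → Y`).

PROOF-ONLY (abc-iut cell, prover abc-iut-f-128 gen 8, offer (O2) «HK-AT-HATTHETA-INHABITANTS» of the RMK164 lane;
no definitions, no facts).  The Θ-level instance files of the spec of record
(`Discharge/Sec1Rmk164ThetaLevelCompletion.lean`, `…HatThetaInstance.lean`, abc-iut p504864/p505745) display ONE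
input, «`(Π^tp_Ÿ)^Θ = D.GtpYddTheta` has compact carrier».  This file:
* `ThetaSetting.isCompact_gtpYdd_of_isCompact_gtpY` / `isCompact_gtpYddTheta_of_isCompact_gtpY` — for EVERY
  `D : ThetaSetting p`: `Π^tp_Ÿ = Π^tp_{Y₂}` is open, hence closed, in `Π^tp_X` and lies in `Π^tp_Y`
  (abc-iut's `Thm16Sub.GtpYdd_eq_GtpYN_two`, `isOpen_GtpYN`, `GtpYdd_le_GtpY`), so «`Π^tp_Y` compact» ⟹
  «`Π^tp_Ÿ` compact» ⟹ «`(Π^tp_Ÿ)^Θ` compact» (continuity of `toTheta`) — the displayed input reduced to the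
  compactness of `Π^tp_Y = Ker(Π^tp_X ↠ Z)`, a property of genuine data (`Δ^tp_Y` profinite, `G_K` compact) that
  the abstract record cannot assert (`Π^tp_X` itself is never compact, `SettingCompactObstruction.lean`);
* at abc-iut-L2-t1's χ-twisted model (`Π^tp_X = (F̂₂ ×_Ẑ ℤ) ⋊_χ G_{ℚ_p}`, `SettingModelChiTheta.lean`) and its
  Tate-sheared stage-2 twin `modelχq p i j` (`SettingModelTateTheta.lean`), `Π^tp_Y = Ker(ê-degree) ⋊ G_{ℚ_p}` IS
  compact — the tree's `SettingModel.isCompact_GtpY_modelχ` / `isCompact_GtpY_modelχq`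
  (`Discharge/Sec2Cor219iAtModelChi.lean`, consumed BY NAME); hence `isCompact_gtpYddTheta_modelχ` /
  `isCompact_gtpYddTheta_modelχq`;
* consequently, for EVERY profinite Θ-quotient record `T : (modelχ p).HatTheta` (abc-iut-f-142's `ThetaSetting.HatTheta`;
  inhabited outright at `modelχ` by f-142's `hatThetaModelχ`), the RMK164 chain holds with NO displayed input:
  `HatTheta.isProfiniteCompletion_ιYdd_modelχ`, `HatTheta.comap_ι_bijective_modelχ`,
  `HatTheta.existsUnique_comap_eq_modelχ` (abc-iut p503502/p504039/p505745 BY NAME), likewise `…_modelχq` at every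
  record over the Tate-sheared model, and — NON-VACUITY of the whole chain — at f-142's CONCRETE record
  `hatThetaModelχ p` (`ThetaSettingHatThetaModelChi.lean`): `isProfiniteCompletion_ιYdd_hatThetaModelχ`,
  `existsUnique_comap_eq_hatThetaModelχ`.
HONEST LABEL: `modelχ` is a SEMI-SYNTHETIC model (consistency evidence for the typed interface, not the tempered
`π₁` of a curve); discharged-at-our-model ≠ proved-in-print; nothing here bears on [IUTchIII] Cor. 3.12.
-/

noncomputable section

open Topology

namespace Literature.AnabelianGeometry.EtaleTheta

open Literature.AnabelianGeometry.SemiGraphs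

/-! ### §1. Every theta setting: «Π^tp_Y compact» ⟹ «(Π^tp_Ÿ)^Θ compact» -/

namespace ThetaSetting

variable {p : ℕ} [Fact p.Prime] (D : ThetaSetting p)

/-- `Π^tp_Ÿ` is closed in `Π^tp_X` (it is the open subgroup `Π^tp_{Y₂}`, abc-iut `Thm16Sub.GtpYdd_eq_GtpYN_two` +
the field `isOpen_GtpYN`). [cite: MochizukiEtTh2009, §1 p.17] -/
theorem isClosed_gtpYdd : IsClosed ((D.GtpYdd : Subgroup D.PiTemp) : Set D.PiTemp) := by
  rw [Thm16Sub.GtpYdd_eq_GtpYN_two D]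
  exact Subgroup.isClosed_of_isOpen _ (D.isOpen_GtpYN 2)

/-- **«`Π^tp_Y` compact» ⟹ «`Π^tp_Ÿ` compact»** (`Π^tp_Ÿ ≤ Π^tp_Y` is closed). [cite: MochizukiEtTh2009, §1 p.17] -/
theorem isCompact_gtpYdd_of_isCompact_gtpY (hY : IsCompact ((D.GtpY : Subgroup D.PiTemp) : Set D.PiTemp)) :
    IsCompact ((D.GtpYdd : Subgroup D.PiTemp) : Set D.PiTemp) :=
  hY.of_isClosed_subset D.isClosed_gtpYdd (fun _ hx => D.GtpYdd_le_GtpY hx)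

/-- **«`Π^tp_Y` compact» ⟹ «`(Π^tp_Ÿ)^Θ` compact»** — the displayed input of the RMK164 Θ-level instance files
(`Sec1Rmk164ThetaLevelCompletion`, `…HatThetaInstance`) reduced to the compactness of `Π^tp_Y = Ker(Π^tp_X ↠ Z)`
(continuity of `toTheta`). [cite: MochizukiEtTh2009, Rmk 1.6.4 p.252] -/
theorem isCompact_gtpYddTheta_of_isCompact_gtpY
    (hY : IsCompact ((D.GtpY : Subgroup D.PiTemp) : Set D.PiTemp)) :
    IsCompact ((D.GtpYddTheta : Subgroup D.GtpTheta) : Set D.GtpTheta) := by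
  rw [GtpYddTheta, Subgroup.coe_map]
  exact (D.isCompact_gtpYdd_of_isCompact_gtpY hY).image D.continuous_toTheta

end ThetaSetting

/-! ### §2. The χ-twisted models: `Π^tp_Y` compact (tree, BY NAME) ⟹ `(Π^tp_Ÿ)^Θ` compact -/

namespace SettingModel

variable (p : ℕ) [Fact p.Prime]

/-- **`Π^tp_Ÿ` is compact in the χ-model** (from the tree's `isCompact_GtpY_modelχ`). [cite: MochizukiEtTh2009, §1 p.17] -/
theorem isCompact_gtpYdd_modelχ :
    IsCompact (((ThetaSetting.modelχ p).GtpYdd : Subgroup (PiTpχ p)) : Set (PiTpχ p)) :=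
  (ThetaSetting.modelχ p).isCompact_gtpYdd_of_isCompact_gtpY (isCompact_GtpY_modelχ p)

/-- **`(Π^tp_Ÿ)^Θ` is compact in the χ-model** — the displayed input of the RMK164 Θ-level instance files,
DISCHARGED at `modelχ`. [cite: MochizukiEtTh2009, Rmk 1.6.4 p.252] -/
theorem isCompact_gtpYddTheta_modelχ :
    IsCompact (((ThetaSetting.modelχ p).GtpYddTheta : Subgroup (ThetaSetting.modelχ p).GtpTheta) :
      Set (ThetaSetting.modelχ p).GtpTheta) :=
  (ThetaSetting.modelχ p).isCompact_gtpYddTheta_of_isCompact_gtpY (isCompact_GtpY_modelχ p)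

variable (i j : ℤ) (hj : Even j)

/-- **`(Π^tp_Ÿ)^Θ` is compact in the Tate-sheared stage-2 model `modelχq p i j`** (from the tree's
`isCompact_GtpY_modelχq`). [cite: MochizukiEtTh2009, Rmk 1.6.4 p.252] -/
theorem isCompact_gtpYddTheta_modelχq :
    IsCompact (((ThetaSetting.modelχq p i j hj).GtpYddTheta : Subgroup (ThetaSetting.modelχq p i j hj).GtpTheta) :
      Set (ThetaSetting.modelχq p i j hj).GtpTheta) :=
  (ThetaSetting.modelχq p i j hj).isCompact_gtpYddTheta_of_isCompact_gtpY (isCompact_GtpY_modelχq p i j hj)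

end SettingModel

/-! ### §3. The RMK164 chain at every profinite Θ-quotient record over the χ-model, hypothesis-free -/

namespace ThetaSetting

namespace HatTheta

variable {p : ℕ} [Fact p.Prime] (T : (ThetaSetting.modelχ p).HatTheta)

/-- **At the χ-model, `ιYdd : (Π^tp_Ÿ)^Θ → ((Π^tp_Ÿ)^Θ)^∧` IS a profinite completion** for every profinite
Θ-quotient record `T` (e.g. abc-iut-f-142's `hatThetaModelχ p`) — NO displayed input.  (In §3 the
commutativity of `ι(Δ_Θ)` is taken as an instance argument — supplied by `T.deltaThetaHat_isMulCommutative` —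
because instance search does not see through the reducible record `modelχ`.)
[cite: MochizukiEtTh2009, Rmk 1.6.4 p.252] -/
theorem isProfiniteCompletion_ιYdd_modelχ : IsProfiniteCompletion T.ιYdd :=
  T.isProfiniteCompletion_ιYdd_of_isCompact (SettingModel.isCompact_gtpYddTheta_modelχ p)

/-- **At the χ-model, `ι^* : H¹(((Π^tp_Ÿ)^Θ)^∧, ι(Δ_Θ)) → H¹((Π^tp_Ÿ)^Θ, ι(Δ_Θ))` is a bijection** (hypothesis-free).
[cite: MochizukiEtTh2009, Rmk 1.6.4 p.252] -/
theorem comap_ι_bijective_modelχ [T.DeltaThetaHat.Normal] [IsMulCommutative T.DeltaThetaHat] :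
    Function.Bijective (ContH1.comap (MonoidHom.id T.GhatTheta) T.DeltaThetaHat T.ι.toMonoidHom
      T.ι.continuous T.map_ι_gtpYddTheta_le_ghatThetaYdd :
        T.H1ThetaHat T.GhatThetaYdd →
          ContH1 ((MonoidHom.id T.GhatTheta).comp T.ι.toMonoidHom) T.DeltaThetaHat
            (ThetaSetting.modelχ p).GtpYddTheta) :=
  T.comap_ι_bijective_of_isCompact (SettingModel.isCompact_gtpYddTheta_modelχ p)

/-- **At the χ-model, the Θ-level «determines, by profinite completion» holds with NO displayed input**: every
class of `H¹((Π^tp_Ÿ)^Θ, ι(Δ_Θ))` is `ι^*` of a UNIQUE class of `H¹(((Π^tp_Ÿ)^Θ)^∧, ι(Δ_Θ))`.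
[cite: MochizukiEtTh2009, Rmk 1.6.4 p.252] -/
theorem existsUnique_comap_eq_modelχ [T.DeltaThetaHat.Normal] [IsMulCommutative T.DeltaThetaHat]
    (y : ContH1 ((MonoidHom.id T.GhatTheta).comp T.ι.toMonoidHom) T.DeltaThetaHat
      (ThetaSetting.modelχ p).GtpYddTheta) :
    ∃! yh : T.H1ThetaHat T.GhatThetaYdd,
      ContH1.comap (MonoidHom.id T.GhatTheta) T.DeltaThetaHat T.ι.toMonoidHom T.ι.continuous
        T.map_ι_gtpYddTheta_le_ghatThetaYdd yh = y :=
  T.existsUnique_comap_eq_of_isCompact (SettingModel.isCompact_gtpYddTheta_modelχ p) y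

/-! ### §4. The same at every record over the Tate-sheared stage-2 model `modelχq` -/

section ModelChiQ

variable {p : ℕ} [Fact p.Prime] {i j : ℤ} {hj : Even j} (T : (ThetaSetting.modelχq p i j hj).HatTheta)

/-- At `modelχq`, `ιYdd` IS a profinite completion for every profinite Θ-quotient record — NO displayed input.
[cite: MochizukiEtTh2009, Rmk 1.6.4 p.252] -/
theorem isProfiniteCompletion_ιYdd_modelχq : IsProfiniteCompletion T.ιYdd :=
  T.isProfiniteCompletion_ιYdd_of_isCompact (SettingModel.isCompact_gtpYddTheta_modelχq p i j hj)

/-- At `modelχq`, `ι^*` on `H¹` of the Θ-level is a bijection (hypothesis-free). [cite: MochizukiEtTh2009, Rmk 1.6.4 p.252] -/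
theorem comap_ι_bijective_modelχq [T.DeltaThetaHat.Normal] [IsMulCommutative T.DeltaThetaHat] :
    Function.Bijective (ContH1.comap (MonoidHom.id T.GhatTheta) T.DeltaThetaHat T.ι.toMonoidHom
      T.ι.continuous T.map_ι_gtpYddTheta_le_ghatThetaYdd :
        T.H1ThetaHat T.GhatThetaYdd →
          ContH1 ((MonoidHom.id T.GhatTheta).comp T.ι.toMonoidHom) T.DeltaThetaHat
            (ThetaSetting.modelχq p i j hj).GtpYddTheta) :=
  T.comap_ι_bijective_of_isCompact (SettingModel.isCompact_gtpYddTheta_modelχq p i j hj)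

/-- At `modelχq`, the Θ-level «determines, by profinite completion» with NO displayed input.
[cite: MochizukiEtTh2009, Rmk 1.6.4 p.252] -/
theorem existsUnique_comap_eq_modelχq [T.DeltaThetaHat.Normal] [IsMulCommutative T.DeltaThetaHat]
    (y : ContH1 ((MonoidHom.id T.GhatTheta).comp T.ι.toMonoidHom) T.DeltaThetaHat
      (ThetaSetting.modelχq p i j hj).GtpYddTheta) :
    ∃! yh : T.H1ThetaHat T.GhatThetaYdd,
      ContH1.comap (MonoidHom.id T.GhatTheta) T.DeltaThetaHat T.ι.toMonoidHom T.ι.continuous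
        T.map_ι_gtpYddTheta_le_ghatThetaYdd yh = y :=
  T.existsUnique_comap_eq_of_isCompact (SettingModel.isCompact_gtpYddTheta_modelχq p i j hj) y

end ModelChiQ

/-! ### §5. At abc-iut-f-142's concrete record `hatThetaModelχ p` (the D1 record inhabited outright at `modelχ`) -/

section Concrete

variable (p : ℕ) [Fact p.Prime]

/-- **Non-vacuity of the whole RMK164 Θ-level chain**: at the concrete profinite Θ-quotient record
`ThetaSetting.hatThetaModelχ p` (abc-iut-f-142, `ThetaSettingHatThetaModelChi.lean` — no binder), `ιYdd` IS a
profinite completion, with NO displayed input anywhere. [cite: MochizukiEtTh2009, Rmk 1.6.4 p.252] -/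
theorem isProfiniteCompletion_ιYdd_hatThetaModelχ :
    IsProfiniteCompletion (ThetaSetting.hatThetaModelχ p).ιYdd :=
  (ThetaSetting.hatThetaModelχ p).isProfiniteCompletion_ιYdd_modelχ

/-- At `hatThetaModelχ p`: the Θ-level «determines, by profinite completion» (existence and uniqueness of the hat
class for EVERY continuous class), with NO displayed input. [cite: MochizukiEtTh2009, Rmk 1.6.4 p.252] -/
theorem existsUnique_comap_eq_hatThetaModelχ [(ThetaSetting.hatThetaModelχ p).DeltaThetaHat.Normal]
    [IsMulCommutative (ThetaSetting.hatThetaModelχ p).DeltaThetaHat]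
    (y : ContH1 ((MonoidHom.id (ThetaSetting.hatThetaModelχ p).GhatTheta).comp
        (ThetaSetting.hatThetaModelχ p).ι.toMonoidHom) (ThetaSetting.hatThetaModelχ p).DeltaThetaHat
      (ThetaSetting.modelχ p).GtpYddTheta) :
    ∃! yh : (ThetaSetting.hatThetaModelχ p).H1ThetaHat (ThetaSetting.hatThetaModelχ p).GhatThetaYdd,
      ContH1.comap (MonoidHom.id _) (ThetaSetting.hatThetaModelχ p).DeltaThetaHat
        (ThetaSetting.hatThetaModelχ p).ι.toMonoidHom (ThetaSetting.hatThetaModelχ p).ι.continuous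
        (ThetaSetting.hatThetaModelχ p).map_ι_gtpYddTheta_le_ghatThetaYdd yh = y :=
  (ThetaSetting.hatThetaModelχ p).existsUnique_comap_eq_modelχ y

end Concrete

end HatTheta

end ThetaSetting

end Literature.AnabelianGeometry.EtaleTheta

end
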